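import Mathlib
import Literature.MathematicalPhysics.QuantumFieldTheory.Balaban1983to89.B9

/-!
# `Balaban1983to89.B9Thm314` — [Balaban1985BackgroundPropagators] Theorem 3.14 (pp. 426–427): the printed
localisation reading, and the printed proof sketch as a KERNEL-CHECKED implication from NAMED LEAVES

CITATION HEADER (lean-in-tree rule 2026-08-18).  Source: T. Bałaban, *Propagators for lattice gauge theories in a
background field*, Commun. Math. Phys. **99**, 389–434 (1985) [Balaban1985BackgroundPropagators] (cell paper B9; held
`paper:balaban1985-cmp99-background-propagators`, journal page = PDF page + 388; quotations read from the page renders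
pp. 410, 426, 427; the "theorem of [2]" = [Balaban1983RegularityDecay] (B4), Commun. Math. Phys. **89**, 571–597 (1983),
Sect. 1 Theorem p. 573 and its proof p. 579, typed in the sibling module `…Balaban1983to89.B4` (`B4.Ineq111_112`)).
This is a SIBLING of `…Balaban1983to89.B9` (it imports it and restates none of its declarations; it USES the sibling's
`B9.thm314_factor_split` (section "Phase 2b", cell b09) and `B9.split_small_factor`; the sibling's pointwise
`B9.dOmega_le_walk_add` is the triangle step that §3(a) below runs along the chain of (3.93)).

THE PRINTED TEXT (verbatim).  p. 426: *"Let us assume that we have two sequences of domains {Ω_j}, {Ω′_j}, both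
satisfying the conditions (2.1)–(2.4) in [4], with M and R sufficiently large, so that all the conditions needed in
this paper are satisfied. We construct operators for both sequences and we define Ω = Ω_k ∩ Ω′_k. Let us take
localizations determined by points y, y′ ∈ Ω^{(k)} (i.e. these are cubes Δ̃(y), Δ̃(y′) in the case of operators G′, G,
G₁, 𝔊, the cube Δ̃(y) and the point y′ in the case of H, H₁, and the points y, y′ in the case of (Q′G′²Q′*)^{−1},
(QGQ*)^{−1}, etc.). We have* **Theorem 3.14.** *If we take a pair of operators constructed for the two sequences {Ω_j},
{Ω′_j}, then their difference satisfies all the inequalities characteristic for operators of the considered type, with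
the additional factor exp(−δ₀d(y, y′, Ω)), d(y, y′, Ω) = inf_{y₁∈Ωᶜ∩T^{(k)}} (|y − y₁| + |y₁ − y′|) (3.154) on the
right-hand sides."*  p. 427 (the whole printed proof): *"This theorem can be proved in exactly the same way as the
corresponding property in the theorem of [2]. We take random walk expansions for both operators, and in the difference
all terms for walks with localizations contained in Ω are cancelled. Remaining terms correspond to walks of the general
type (3.107), for which at least one localization X_i intersects Ωᶜ. Then the exponential factor in (3.108) gives the
factor (3.154) (after adjusting a definition of δ₀)."*  p. 410, (3.93): *"d(ω, y, y′) = inf_{(y₁,…,y_n)} (d(y, y₁) +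
d(y₁, y₂) + … + d(y_{n−1}, y_n) + d(y_n, y′)), the infimum is taken over all sequences (y₁, …, y_n) of points
y_i ∈ □_i ∈ 𝔅"* (for (3.108): *"the infimum is taken over y_i ∈ X_i ∩ 𝔅"*, p. 413).  B4 p. 579 (the cited template):
*"The terms with ω such that □_{ω_i} are interior cubes of Ω are the same in both representations, so they cancel in the
difference … at least one □_{ω_i} intersects the boundary ∂Ω … n ≥ M^{−1} sup_{x₁∈Ωᶜ} (dist({x, x′}, x₁) +
dist(x₁, supp f)) − 3"*; B4 p. 573: constants *"δ₀, c₀, R₀ … depending on d, M only"* (cell GAPS G-B4-01a).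

WHAT IS REPRODUCED (statement level, surge node T06.14 "sharpen", unit `b2b-balaban-pv05`).
§1  The STATEMENT with the printed localisation restriction y, y′ ∈ Ω^{(k)} (predicate `OmK`) and the extra factor
    inserted in ALL local inequalities (3.42)–(3.46) (`IneqSupF`, `IneqL2F`, `IneqHolderF`, `Thm314LocalPrinted`); its
    sup-entry part `Thm314SupOn` (`supOn_of_local`); the sibling's `B9.Thm314Printed` (unit r1) is, by
    `thm314Printed_iff_supOn_univ`, the reading WITHOUT the restriction (OmK ≡ True); and the reading with an
    M-DEPENDENT constant B₀(M) and (3.154)-rate δ_Ω(M) (`Thm314SupDep`; `supOn_iff_dep_const`: the uniform reading is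
    the case of constant functions).
§2  The three sentences of the printed proof as NAMED LEAVES over the sibling's carriers: the CANCELLATION leaf
    `DiffExpansionPrinted` (the difference is represented by a convergent expansion of type (3.107) all of whose walks
    touch Ωᶜ, with the term bound (3.108)); the GEOMETRY of (3.93)/(3.154) as data + laws (`LocData`, `LocData.Laws`:
    two distances kept distinct — the multiscale d of (3.93) = [4] (2.46) for the walk, the lattice distance |·| of
    T^{(k)} for (3.154), with |y − y′| ≤ d(y, y′)); the SUMMATION leaf `RWSumFactorYields` (the Sect. C summation,
    by reference exactly as `B9.RWSumsYieldIneqs`, GAPS G-B9-07, here with a walk-independent extra factor carried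
    through); and, for the template's own mechanism, the STEP COUNT of B4 p. 579 (`StepCountPrinted`).
§3  KERNEL-CHECKED: (a) the metric step behind *"the exponential factor in (3.108) gives the factor (3.154)"*:
    d(y, y′, Ω) ≤ d(ω, y, y′) + 2·diam for every walk touching Ωᶜ (`dOmega_le_wdist_add`, from the chain structure of
    (3.93): `chainSum_ge_ends`, `chainSum_ge_mem`, and the sibling's pointwise `B9.dOmega_le_walk_add` idea);
    (b) the two printed ways of "adjusting δ₀" as per-term inequalities on the factor of (3.108): ROUTE (i) (this
    paper's sentence) `walkFactorS_split_exp` — half the rate of e^{−½δ₀d(ω,y,y′)} is traded for e^{−¼δ₀d(y,y′,Ω)} at the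
    price of the CONSTANT e^{½δ₀·diam}; ROUTE (ii) (B4 p. 579) `walkFactor_split_steps` — the factor M^{−½|ω|} and the
    step count |ω| ≥ (κM)^{−1}d(y, y′, Ω) − b give e^{−(κM)^{−1}d(y,y′,Ω)} at the price of the constant e^{b}, i.e. an
    M-DEPENDENT RATE; (c) the assembled implications `thm314Dep_of_leaves_exp` (leaves ⇒ `Thm314SupDep` with
    B₀(M) = C·e^{½δ₀φ(M)}·B₁, φ(M) = the diameter bound of the localisation domains, rate ¼δ₀ uniform),
    `thm314Dep_of_leaves_steps` (leaves ⇒ `Thm314SupDep` with B₀ uniform, rate (κM)^{−1}), and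
    `thm314SupOn_of_leaves_exp` / `thm314Printed_of_leaves` (leaves ⇒ the UNIFORM reading, resp. literally
    `B9.Thm314Printed`, under the ADDITIONAL hypothesis of an M-uniform diameter bound φ ≡ r₀).
WHAT IS *NOT* REPRODUCED OR ASSERTED: Theorem 3.14 itself; the leaves (they are hypotheses, never discharged here); that
the localisation domains of (3.107) possess an M-uniform |·|-diameter bound — they do not in the construction of Sect. C
(cubes of 𝒟_j have side of order M·L^jη, i.e. of order M lattice units at the top scale), which is exactly why the
printed sketch delivers `Thm314SupDep` (M-dependent constant, route (i), or M-dependent rate, route (ii) = B4's own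
"δ₀ depending on d, M") and not the M-uniform `B9.Thm314Printed` — cell GAPS.md G-B9-08 (r1), G-B9-19 / C-B9-12 (b09)
and this unit's row; the other characteristic inequalities ((3.46), (3.43)–(3.45), the kernels (3.48), (3.133)) are
carried in §1's statement only, the bookkeeping of §3 is written for the sup entries (3.42) ("Similar estimates hold for
the other norms", p. 410, would feed the same leaves).  DICTIONARY: `OmK i y` = y ∈ Ω^{(k)}; `dOmega i y y′` =
d(y, y′, Ω) of (3.154); `LocData.X ω m` = X_m ∩ 𝔅 for the m-th localisation domain of ω; `LocData.Meets ω m` =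
X_m ∩ Ωᶜ ≠ ∅; `LocData.ρ` = |· − ·| on T (ℓ¹, [4] p. 223); `LocData.inΩc q` = q ∈ Ωᶜ ∩ T^{(k)}; `LocData.diam` = a bound
for the |·|-distance from any 𝔅-point of a localisation domain meeting Ωᶜ to Ωᶜ ∩ T^{(k)}.  NOTHING of the series is
asserted; value = typed skeleton + located gap, NOT summit progress.  Companion rows: cell `GAPS.md` G-pv05-1,
`DIVERGENCE.md` D-pv05.1.
-/

namespace Literature.MathematicalPhysics.QuantumFieldTheory.Balaban1983to89.B9Thm314

open Literature.MathematicalPhysics.QuantumFieldTheory.Balaban1983to89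
open Literature.MathematicalPhysics.QuantumFieldTheory.Balaban1983to89.B9

variable {g : Geometry} {B : Backgrounds}

/-! ## §1 The statement of Theorem 3.14 -/

/-- The sup entries (3.42) for one U with constants (B₀, δ₀), the localisation RESTRICTION `P` on y, y′ (printed:
y, y′ ∈ Ω^{(k)}, p. 426) and an EXTRA FACTOR `F y y′` on the right-hand side (printed: exp(−δ₀d(y, y′, Ω)), (3.154)). [cite: Balaban1985BackgroundPropagators, (3.42) p.397 + Thm 3.14 (3.154) pp.426–427] -/
def IneqSupF (K : KernelFamily g B) (B₀ δ₀ : ℝ) (P : g.Site → Prop) (F : g.Site → g.Site → ℝ)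
    (U : B.Cfg) : Prop :=
  ∀ (n : Fin 4) (lam : g.Loc) (y y' : g.Site), P y → P y' → g.suppIn lam y' →
    K.e n U lam y ≤ B₀ * pref4 (g.len y) n * Real.exp (-(δ₀ * g.dist y y')) * F y y' * g.supNorm lam

/-- The L² entries (3.46) with restriction `P` and extra factor `F`. [cite: Balaban1985BackgroundPropagators, (3.46) p.398 + Thm 3.14 (3.154) pp.426–427] -/
def IneqL2F (K : KernelFamily g B) (B₀ δ₀ : ℝ) (P : g.Site → Prop) (F : g.Site → g.Site → ℝ)
    (U : B.Cfg) : Prop :=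
  ∀ (n : Fin 6) (lam : g.Loc) (h : g.Cut) (y y' : g.Site), P y → P y' → g.cutIn h y → g.suppIn lam y' →
    K.l2 n U lam h ≤
      B₀ * pref6 (g.len y) n * g.cutSup h * Real.exp (-(δ₀ * g.dist y y')) * F y y' * g.l2Norm lam

/-- The Hölder entries (3.43)–(3.45) with restriction `P` and extra factor `F`. [cite: Balaban1985BackgroundPropagators, (3.43)–(3.45) p.398 + Thm 3.14 (3.154) pp.426–427] -/
def IneqHolderF (K : KernelFamily g B) (Bβ Bε : ℝ → ℝ) (Bεβ : ℝ → ℝ → ℝ) (δ₀ : ℝ) (P : g.Site → Prop)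
    (F : g.Site → g.Site → ℝ) (U : B.Cfg) : Prop :=
  (∀ (β : ℝ) (lam : g.Loc) (ζ : g.Cut) (y y' : g.Site), 0 ≤ β → β < 1 → P y → P y' → g.cutIn ζ y →
      g.suppIn lam y' →
      K.h1 U lam β ζ ≤ Bβ β * (g.len y) ^ (1 - β) * g.cutH β ζ * Real.exp (-(δ₀ * g.dist y y')) * F y y' *
        g.supNorm lam) ∧
  (∀ (ε : ℝ) (lam : g.Loc) (y y' : g.Site), 0 < ε → ε ≤ 1 → P y → P y' → g.suppIn lam y' →
      K.e4 U lam y ≤ Bε ε * Real.exp (-(δ₀ * g.dist y y')) * F y y' * (g.holder ε lam + g.supNorm lam)) ∧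
  (∀ (ε β : ℝ) (lam : g.Loc) (ζ : g.Cut) (y y' : g.Site), 0 < ε → ε ≤ 1 → 0 ≤ β → β < 1 → P y → P y' →
      g.cutIn ζ y → g.suppIn lam y' →
      K.h2 U lam β ζ ≤ Bεβ ε β * (g.len y) ^ (-β) * g.cutH β ζ * Real.exp (-(δ₀ * g.dist y y')) * F y y' *
        (g.holder (β + ε) lam + g.supNorm lam))

/-- **Theorem 3.14, local reading** (pp. 426–427 [PDF 38–39], verbatim in the module docstring): for the difference
`Kdiff i` of the two operators (seen through the quantities of (3.42)–(3.46)), ALL the local characteristic inequalities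
hold with the additional factor exp(−δ₀d(y, y′, Ω)) and for localisations y, y′ ∈ Ω^{(k)} (`OmK`); constants quantified
BEFORE the instance i (= torus, k, both sequences {Ω_j}, {Ω′_j}, M), thresholds "M and R sufficiently large",
"Mα₀ ≤ a₀" as in Thm 3.1.  The global entries (3.47) carry no localisation and are not part of the statement.  The
print does not say on what the adjusted δ₀ depends (see `Thm314SupDep` and §3). [cite: Balaban1985BackgroundPropagators, Thm 3.14 (3.154) pp.426–427] -/
def Thm314LocalPrinted {I : Type} (c35 : ℝ) (geo : I → Geometry) (bg : I → Backgrounds)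
    (Kdiff : ∀ i, KernelFamily (geo i) (bg i)) (OmK : ∀ i, (geo i).Site → Prop)
    (dOmega : ∀ i, (geo i).Site → (geo i).Site → ℝ) : Prop :=
  ∃ M₅ δ₀ a₀ B₀ : ℝ, ∃ Bβ Bε : ℝ → ℝ, ∃ Bεβ : ℝ → ℝ → ℝ,
    0 < M₅ ∧ 0 < δ₀ ∧ 0 < a₀ ∧ 0 < B₀ ∧
    ∀ i : I, M₅ ≤ (geo i).M → ∀ α₀ : ℝ, 0 < α₀ → (geo i).M * α₀ ≤ a₀ →
      ∀ U : (bg i).Cfg, (bg i).Reg335 c35 α₀ U →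
        IneqSupF (Kdiff i) B₀ δ₀ (OmK i) (fun y y' => Real.exp (-(δ₀ * dOmega i y y'))) U ∧
        IneqL2F (Kdiff i) B₀ δ₀ (OmK i) (fun y y' => Real.exp (-(δ₀ * dOmega i y y'))) U ∧
        IneqHolderF (Kdiff i) Bβ Bε Bεβ δ₀ (OmK i) (fun y y' => Real.exp (-(δ₀ * dOmega i y y'))) U

/-- The sup-entry part of Theorem 3.14 with the localisation restriction `OmK` — M-UNIFORM constants (the reading of
`B9.Thm314Printed`, which is the case OmK ≡ True: `thm314Printed_iff_supOn_univ`). [cite: Balaban1985BackgroundPropagators, Thm 3.14 (3.154) pp.426–427] -/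
def Thm314SupOn {I : Type} (c35 : ℝ) (geo : I → Geometry) (bg : I → Backgrounds)
    (Kdiff : ∀ i, KernelFamily (geo i) (bg i)) (OmK : ∀ i, (geo i).Site → Prop)
    (dOmega : ∀ i, (geo i).Site → (geo i).Site → ℝ) : Prop :=
  ∃ M₅ δ₀ a₀ B₀ : ℝ, 0 < M₅ ∧ 0 < δ₀ ∧ 0 < a₀ ∧ 0 < B₀ ∧
    ∀ i : I, M₅ ≤ (geo i).M → ∀ α₀ : ℝ, 0 < α₀ → (geo i).M * α₀ ≤ a₀ →
      ∀ U : (bg i).Cfg, (bg i).Reg335 c35 α₀ U →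
        IneqSupF (Kdiff i) B₀ δ₀ (OmK i) (fun y y' => Real.exp (-(δ₀ * dOmega i y y'))) U

/-- The sup-entry part of Theorem 3.14 with the constant B₀ = B₀(M) and the rate δ_Ω = δ_Ω(M) of the factor (3.154)
allowed to DEPEND ON M (thresholds M₅, a₀ and the rate δ₀ of e^{−δ₀d(y,y′)} fixed).  This is the shape the printed
proof sketch delivers (§3); B4's template theorem has "δ₀ … depending on d, M only" (p. 573). [cite: Balaban1985BackgroundPropagators, Thm 3.14 proof p.427]
[cite: Balaban1983RegularityDecay, Theorem p.573 + proof p.579] -/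
def Thm314SupDep {I : Type} (c35 : ℝ) (geo : I → Geometry) (bg : I → Backgrounds)
    (Kdiff : ∀ i, KernelFamily (geo i) (bg i)) (OmK : ∀ i, (geo i).Site → Prop)
    (dOmega : ∀ i, (geo i).Site → (geo i).Site → ℝ) (M₅ δ₀ a₀ : ℝ) (B₀ δΩ : ℝ → ℝ) : Prop :=
  ∀ i : I, M₅ ≤ (geo i).M → ∀ α₀ : ℝ, 0 < α₀ → (geo i).M * α₀ ≤ a₀ →
    ∀ U : (bg i).Cfg, (bg i).Reg335 c35 α₀ U →
      IneqSupF (Kdiff i) (B₀ (geo i).M) δ₀ (OmK i)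
        (fun y y' => Real.exp (-(δΩ (geo i).M * dOmega i y y'))) U

section Statement

variable {I : Type} {c35 : ℝ} {geo : I → Geometry} {bg : I → Backgrounds}
  {Kdiff : ∀ i, KernelFamily (geo i) (bg i)} {OmK : ∀ i, (geo i).Site → Prop}
  {dOmega : ∀ i, (geo i).Site → (geo i).Site → ℝ}

/-- The local reading contains the sup-entry reading (projection). [cite: Balaban1985BackgroundPropagators, Thm 3.14 pp.426–427] -/
theorem supOn_of_local (h : Thm314LocalPrinted c35 geo bg Kdiff OmK dOmega) :
    Thm314SupOn c35 geo bg Kdiff OmK dOmega := by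
  obtain ⟨M₅, δ₀, a₀, B₀, Bβ, Bε, Bεβ, hM, hδ, ha, hB, H⟩ := h
  exact ⟨M₅, δ₀, a₀, B₀, hM, hδ, ha, hB, fun i hMi α₀ hα hMa U hU => (H i hMi α₀ hα hMa U hU).1⟩

/-- `B9.Thm314Printed` (unit r1) IS the sup-entry reading without the localisation restriction (OmK ≡ True), by
unfolding. [cite: Balaban1985BackgroundPropagators, Thm 3.14 pp.426–427] -/
theorem thm314Printed_iff_supOn_univ :
    Thm314Printed c35 geo bg Kdiff dOmega ↔ Thm314SupOn c35 geo bg Kdiff (fun _ _ => True) dOmega := by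
  simp only [Thm314Printed, Thm314SupOn, IneqSupF, true_implies]

/-- The M-uniform reading is the M-dependent reading with CONSTANT functions (by `Iff.rfl`). [folklore] -/
theorem supOn_iff_dep_const :
    Thm314SupOn c35 geo bg Kdiff OmK dOmega ↔
      ∃ M₅ δ₀ a₀ B₀ : ℝ, 0 < M₅ ∧ 0 < δ₀ ∧ 0 < a₀ ∧ 0 < B₀ ∧
        Thm314SupDep c35 geo bg Kdiff OmK dOmega M₅ δ₀ a₀ (fun _ => B₀) (fun _ => δ₀) :=
  Iff.rfl

end Statement

/-! ## §2 The leaves of the printed proof -/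

/-- CANCELLATION LEAF (p. 427: *"We take random walk expansions for both operators, and in the difference all terms for
walks with localizations contained in Ω are cancelled. Remaining terms correspond to walks of the general type (3.107),
for which at least one localization X_i intersects Ωᶜ"*), typed over the sibling's `RWExpansion`: the difference
operator is represented by a CONVERGENT expansion `Ediff i` every walk of which touches Ωᶜ (`Touches`), whose terms obey
the bound (3.108) with constants depending on d, L only, for M ≥ M₂, Mα₀ ≤ a₀, U satisfying (3.35).  Implicit
requirement recorded by r1 (G-B9-08): the local factors R_α(X) of the two sequences coincide whenever the enlarged
domain lies inside Ω.  A hypothesis, never discharged here. [cite: Balaban1985BackgroundPropagators, Thm 3.14 proof p.427 + Thm 3.10 (3.107)–(3.108) pp.415–416] -/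
def DiffExpansionPrinted {I : Type} (c35 : ℝ) (geo : I → Geometry) (bg : I → Backgrounds)
    (Ediff : ∀ i, RWExpansion (geo i) (bg i)) (Touches : ∀ i, (Ediff i).Walk → Prop) : Prop :=
  ∃ M₂ a₀ δ₀ C c : ℝ, 0 < M₂ ∧ 0 < a₀ ∧ 0 < δ₀ ∧ 0 < C ∧ 0 < c ∧
    ∀ i : I, M₂ ≤ (geo i).M → ∀ α₀ : ℝ, 0 < α₀ → (geo i).M * α₀ ≤ a₀ →
      ∀ U : (bg i).Cfg, (bg i).Reg335 c35 α₀ U →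
        (Ediff i).Converges U ∧ (∀ ω : (Ediff i).Walk, Touches i ω) ∧
        ∀ (ω : (Ediff i).Walk) (lam : (geo i).Loc) (y y' : (geo i).Site),
          (Ediff i).first ω y → (Ediff i).last ω y' → (geo i).suppIn lam y' →
            (Ediff i).term U ω lam y ≤ ((geo i).len y) ^ 2 *
              walkFactor C c (geo i).M δ₀ ((Ediff i).wlen ω) ((Ediff i).wdist ω y y') * (geo i).supNorm lam

/-- The chain length d(y, y₁) + d(y₁, y₂) + … + d(y_n, y′) of (3.93) through a list of intermediate points. [cite: Balaban1985BackgroundPropagators, (3.93) p.410] -/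
def chainSum {α : Type*} (d : α → α → ℝ) : α → List α → α → ℝ
  | y, [], y' => d y y'
  | y, z :: l, y' => d y z + chainSum d z l y'

/-- The GEOMETRIC DATA of (3.93) and (3.154) for one expansion: the point set of T carrying the lattice distance
`ρ` = |· − ·| of (3.154) and the embedding `ι` of 𝔅 into it; `inΩc q` = q ∈ Ωᶜ ∩ T^{(k)}; `X ω m y` = y ∈ X_m ∩ 𝔅, the
𝔅-points of the m-th localisation domain of ω (m = 0, …, |ω|); `Meets ω m` = X_m ∩ Ωᶜ ≠ ∅; `diam` = a number bounding
the |·|-distance from every 𝔅-point of a localisation domain that meets Ωᶜ to the set Ωᶜ ∩ T^{(k)} (of the order of the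
diameter of the domains, i.e. of order M at the top scale).  Data only; the laws are `LocData.Laws`. [cite: Balaban1985BackgroundPropagators, (3.93) p.410 + (3.107) p.415 + (3.154) p.427] -/
structure LocData (g : Geometry) (B : Backgrounds) (E : RWExpansion g B) where
  Pt : Type
  ι : g.Site → Pt
  ρ : Pt → Pt → ℝ
  inΩc : Pt → Prop
  X : E.Walk → ℕ → g.Site → Prop
  Meets : E.Walk → ℕ → Prop
  diam : ℝ

/-- *"at least one localization X_i intersects Ωᶜ"* (p. 427). [cite: Balaban1985BackgroundPropagators, Thm 3.14 proof p.427] -/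
def LocData.Touches {E : RWExpansion g B} (D : LocData g B E) (ω : E.Walk) : Prop :=
  ∃ m : ℕ, m ≤ E.wlen ω ∧ D.Meets ω m

/-- The LAWS of the geometric data actually used by the sketch: `ρ` is a pseudo-metric (|·| of T); the multiscale
distance d of (3.93) (= [4] (2.46) p. 231) satisfies the triangle inequality ([4] (2.54) p. 233: *"This is of course the
triangle inequality for our distance"*) and DOMINATES the lattice distance, |y − y′| ≤ d(y, y′) ([4] (2.46): d is an infimum
over contours Γ from y to y′ of Σ_j (L^jη)^{−1}|Γ ∩ B^j(Λ_j)| with every weight (L^jη)^{−1} = L^{k−j} ≥ 1 in unit-lattice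
units, and |Γ| ≥ |y − y′|); d(y, y′, Ω) of (3.154) is
AT MOST each |y − y₁| + |y₁ − y′|, y₁ ∈ Ωᶜ ∩ T^{(k)} (the only half of "inf" needed); `near` = the meaning of `diam`;
`first_mem` = y ∈ X₀; `chain` = (3.93) as an infimum over chains y₁ ∈ X₁, …, y_n ∈ X_n that is ATTAINED or undercut by
some chain (finite point sets) — again the only half needed.  Hypotheses about the intended model, never discharged
here. [cite: Balaban1985BackgroundPropagators, (3.93) p.410 + (3.154) p.427]
[cite: Balaban1984PropagatorsII, (2.46) p.231 + (2.54) p.233] -/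
structure LocData.Laws {E : RWExpansion g B} (D : LocData g B E) (dOmega : g.Site → g.Site → ℝ) : Prop where
  ρ_self : ∀ p, D.ρ p p = 0
  ρ_symm : ∀ p q, D.ρ p q = D.ρ q p
  ρ_triangle : ∀ p q r, D.ρ p r ≤ D.ρ p q + D.ρ q r
  d_triangle : ∀ y z y', g.dist y y' ≤ g.dist y z + g.dist z y'
  cmp : ∀ y y', D.ρ (D.ι y) (D.ι y') ≤ g.dist y y'
  dOmega_le : ∀ y y' q, D.inΩc q → dOmega y y' ≤ D.ρ (D.ι y) q + D.ρ q (D.ι y')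
  near : ∀ ω m p, D.Meets ω m → D.X ω m p → ∃ q, D.inΩc q ∧ D.ρ (D.ι p) q ≤ D.diam
  first_mem : ∀ ω y, E.first ω y → D.X ω 0 y
  chain : ∀ ω y y', E.first ω y → E.last ω y' →
    ∃ l : List g.Site, l.length = E.wlen ω ∧ (∀ (m : ℕ) (hm : m < l.length), D.X ω (m + 1) (l[m])) ∧
      chainSum g.dist y l y' ≤ E.wdist ω y y'

/-- The walk-term factor with a GENERAL power M^{−s} per step: C·(cM^{−s})^{|ω|}·e^{−½δ₀d(ω,y,y′)}.  For s = 1 this is the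
sibling's `walkFactor` ((O(1)M^{−1/2})^{|ω|}M^{−½|ω|} = (O(1)M^{−1})^{|ω|}, `walkFactor_eq_walkFactorS`); route (ii) of §3
spends M^{−½|ω|} and keeps s = ½ for the summation. [cite: Balaban1985BackgroundPropagators, (3.94) p.410 + (3.108) p.416] -/
noncomputable def walkFactorS (C c M s δ₀ : ℝ) (n : ℕ) (dω : ℝ) : ℝ :=
  C * (c * M ^ (-s)) ^ n * Real.exp (-(δ₀ / 2 * dω))

/-- SUMMATION LEAF with an extra factor (the Sect. C summation "from the bound (3.89) and Lemma 2.1 … exactly the same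
as in proofs of Proposition 1.2 [3] and Proposition 2.2 [4]", p. 409, and "From (3.108) it follows that the expansion
(3.107) is convergent in all norms", p. 416 — by reference, GAPS G-B9-07, exactly as the sibling's `RWSumsYieldIneqs`):
if an operator is represented by a convergent expansion whose terms obey the (3.108)-type bound with per-step factor
cM^{−s} (s > 0), rate δ, an overall constant A ≥ 0 and a walk-independent factor F(y, y′) ≥ 0, then for M ≥ M₃(c, s, δ)
its sup entries obey (3.42) with constant A·B₁ and rate δ₁ (B₁, δ₁ depending on c, s, δ, d, L only) and the SAME extra
factor F.  A hypothesis, never discharged here (its convergence arithmetic is the sibling's `walkSum_le`). [cite: Balaban1985BackgroundPropagators, Thm 3.7 proof p.409 + Thm 3.10 proof p.416] -/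
def RWSumFactorYields {I : Type} (geo : I → Geometry) (bg : I → Backgrounds)
    (E : ∀ i, RWExpansion (geo i) (bg i)) (K : ∀ i, KernelFamily (geo i) (bg i))
    (P : ∀ i, (geo i).Site → Prop) : Prop :=
  ∀ c s δ : ℝ, 0 < c → 0 < s → 0 < δ →
    ∃ M₃ B₁ δ₁ : ℝ, 0 < M₃ ∧ 0 < B₁ ∧ 0 < δ₁ ∧
      ∀ i : I, M₃ ≤ (geo i).M → ∀ (U : (bg i).Cfg) (A : ℝ) (F : (geo i).Site → (geo i).Site → ℝ),
        0 ≤ A → (∀ y y', 0 ≤ F y y') → (E i).Converges U →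
        (∀ (ω : (E i).Walk) (lam : (geo i).Loc) (y y' : (geo i).Site),
            (E i).first ω y → (E i).last ω y' → P i y → P i y' → (geo i).suppIn lam y' →
              (E i).term U ω lam y ≤ ((geo i).len y) ^ 2 *
                walkFactorS A c (geo i).M s δ ((E i).wlen ω) ((E i).wdist ω y y') * F y y' *
                  (geo i).supNorm lam) →
        IneqSupF (K i) (A * B₁) δ₁ (P i) F U

/-- STEP-COUNT LEAF = the mechanism printed in the cited template (B4 p. 579: *"… with the additional restriction that
at least one □_{ω_i} intersects the boundary ∂Ω … n ≥ M^{−1} sup_{x₁∈Ωᶜ}(dist({x, x′}, x₁) + dist(x₁, supp f)) − 3"*):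
a walk from y to y′ touching Ωᶜ has at least (κM)^{−1}d(y, y′, Ω) − b steps (consecutive localisation domains intersect
and have |·|-diameter ≤ κM up to constants).  A hypothesis (derivable from the chain structure like
`dOmega_le_wdist_add`; not derived here). [cite: Balaban1983RegularityDecay, proof of the Theorem, p.579]
[cite: Balaban1985BackgroundPropagators, Thm 3.14 proof p.427] -/
def StepCountPrinted (E : RWExpansion g B) (Touches : E.Walk → Prop) (dOmega : g.Site → g.Site → ℝ)
    (κM b : ℝ) : Prop :=
  ∀ (ω : E.Walk) (y y' : g.Site), E.first ω y → E.last ω y' → Touches ω →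
    κM⁻¹ * dOmega y y' - b ≤ (E.wlen ω : ℝ)

/-! ## §3 Kernel-checked: the metric step, the two adjustments of δ₀, the assembled implications -/

section Chain

variable {α : Type*} {d : α → α → ℝ}

/-- A chain from y to y′ is at least d(y, y′) long (triangle inequality, induction on the chain). [folklore] -/
theorem chainSum_ge_ends (htri : ∀ a b c, d a c ≤ d a b + d b c) :
    ∀ (l : List α) (y y' : α), d y y' ≤ chainSum d y l y'
  | [], _, _ => le_rfl
  | z :: l, y, y' => by
      have ih := chainSum_ge_ends htri l z y'
      have ht := htri y z y'
      show d y y' ≤ d y z + chainSum d z l y'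
      linarith

/-- A chain from y to y′ through p is at least d(y, p) + d(p, y′) long. [folklore] -/
theorem chainSum_ge_mem (htri : ∀ a b c, d a c ≤ d a b + d b c) :
    ∀ (l : List α) (y y' p : α), p ∈ l → d y p + d p y' ≤ chainSum d y l y'
  | [], _, _, _, h => by simp at h
  | z :: l, y, y', p, h => by
      show d y p + d p y' ≤ d y z + chainSum d z l y'
      rcases List.mem_cons.mp h with hpz | hmem
      · subst hpz
        have h1 := chainSum_ge_ends htri l p y'
        linarith
      · have h1 := chainSum_ge_mem htri l z y' p hmem
        have h2 := htri y z p
        linarith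

end Chain

section Metric

variable {E : RWExpansion g B}

/-- THE METRIC STEP of the sketch (kernel-checked from `LocData.Laws`): for a walk ω from y to y′ one of whose
localisation domains meets Ωᶜ, d(y, y′, Ω) ≤ d(ω, y, y′) + 2·diam.  (Chain of (3.93) through a 𝔅-point p of the
touching domain; |y − y₁| + |y₁ − y′| ≤ |y − p| + |p − y′| + 2|p − y₁| ≤ d(y, p) + d(p, y′) + 2·diam ≤ chain + 2·diam;
the pointwise triangle step is the sibling's `B9.dOmega_le_walk_add`.) [folklore] -/
theorem dOmega_le_wdist_add (D : LocData g B E) {dOmega : g.Site → g.Site → ℝ} (L : D.Laws dOmega)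
    {ω : E.Walk} {y y' : g.Site} (hy : E.first ω y) (hy' : E.last ω y') (ht : D.Touches ω) :
    dOmega y y' ≤ E.wdist ω y y' + 2 * D.diam := by
  obtain ⟨l, hlen, hX, hsum⟩ := L.chain ω y y' hy hy'
  obtain ⟨m, hm, hmeet⟩ := ht
  -- the common final step, for a 𝔅-point p of the touching domain lying on (or at the start of) the chain
  have key : ∀ p : g.Site, D.X ω m p →
      D.ρ (D.ι y) (D.ι p) + D.ρ (D.ι p) (D.ι y') ≤ E.wdist ω y y' →
      dOmega y y' ≤ E.wdist ω y y' + 2 * D.diam := by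
    intro p hp hchain
    obtain ⟨q, hq, hpq⟩ := L.near ω m p hmeet hp
    have h0 := L.dOmega_le y y' q hq
    have h1 := L.ρ_triangle (D.ι y) (D.ι p) q
    have h2 := L.ρ_triangle q (D.ι p) (D.ι y')
    have h3 := L.ρ_symm q (D.ι p)
    linarith
  rcases Nat.eq_zero_or_pos m with hm0 | hmpos
  · -- the touching domain is X₀ ∋ y
    subst hm0
    refine key y (L.first_mem ω y hy) ?_
    have h1 := L.ρ_self (D.ι y)
    have h2 := L.cmp y y'
    have h3 := chainSum_ge_ends L.d_triangle l y y'
    linarith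
  · -- the touching domain is X_m, m ≥ 1, and the chain point y_m = l[m-1] lies in it
    have hlt : m - 1 < l.length := by omega
    refine key (l[m - 1]) ?_ ?_
    · have := hX (m - 1) hlt
      rwa [Nat.sub_add_cancel hmpos] at this
    · have h1 := L.cmp y (l[m - 1])
      have h2 := L.cmp (l[m - 1]) y'
      have h3 := chainSum_ge_mem L.d_triangle l y y' (l[m - 1]) (List.getElem_mem hlt)
      linarith

end Metric

section Arithmetic

/-- `walkFactor` is `walkFactorS` with s = 1 (the sibling's `split_small_factor`). [folklore] -/
theorem walkFactor_eq_walkFactorS {C c M δ₀ dω : ℝ} {n : ℕ} (hM : 0 < M) :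
    walkFactor C c M δ₀ n dω = walkFactorS C c M 1 δ₀ n dω := by
  unfold walkFactor walkFactorS
  rw [mul_assoc C, ← split_small_factor c M hM n, Real.rpow_neg_one]

/-- ROUTE (i), this paper's sentence *"the exponential factor in (3.108) gives the factor (3.154) (after adjusting a
definition of δ₀)"*, as a per-term inequality: from d(y, y′, Ω) ≤ d(ω, y, y′) + 2r (`dOmega_le_wdist_add`) the factor
e^{−½δd(ω,y,y′)} is at most e^{½δr}·e^{−¼δd(ω,y,y′)}·e^{−¼δd(y,y′,Ω)} (the sibling's `thm314_factor_split` at rate ½δ): HALF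
THE RATE survives for the summation, the factor (3.154) appears at rate ¼δ, the constant grows by e^{½δ·r}. [folklore] -/
theorem walkFactorS_split_exp {A c M s δ r dω dΩ : ℝ} {n : ℕ} (hA : 0 ≤ A) (hc : 0 ≤ c) (hM : 0 < M)
    (hδ : 0 ≤ δ) (h : dΩ ≤ dω + 2 * r) :
    walkFactorS A c M s δ n dω ≤
      walkFactorS (A * Real.exp (δ / 2 * r)) c M s (δ / 2) n dω * Real.exp (-(δ / 2 / 2 * dΩ)) := by
  unfold walkFactorS
  have hsplit := thm314_factor_split (δ := δ / 2) (r := r) (dω := dω) (dΩ := dΩ) (by linarith) h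
  have hP : 0 ≤ A * (c * M ^ (-s)) ^ n := by positivity
  calc A * (c * M ^ (-s)) ^ n * Real.exp (-(δ / 2 * dω))
      ≤ A * (c * M ^ (-s)) ^ n *
          (Real.exp (δ / 2 * r) * Real.exp (-(δ / 2 / 2 * dω)) * Real.exp (-(δ / 2 / 2 * dΩ))) :=
        mul_le_mul_of_nonneg_left hsplit hP
    _ = A * Real.exp (δ / 2 * r) * (c * M ^ (-s)) ^ n * Real.exp (-(δ / 2 / 2 * dω)) *
          Real.exp (-(δ / 2 / 2 * dΩ)) := by ring

/-- ROUTE (ii), the template's mechanism (B4 p. 579): if M^{−1/2} ≤ e^{−1} and the walk has at least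
(κM)^{−1}d(y, y′, Ω) − b steps, then M^{−½|ω|} ≤ e^{−|ω|} ≤ e^{b}·e^{−(κM)^{−1}d(y,y′,Ω)}, so the (3.108) factor is at most the
s = ½ factor times e^{−(κM)^{−1}d(y,y′,Ω)} with constant C·e^{b}: an M-DEPENDENT RATE, no loss in the constant. [folklore] -/
theorem walkFactor_split_steps {C c M δ₀ dω dΩ κM b : ℝ} {n : ℕ} (hC : 0 ≤ C) (hc : 0 ≤ c) (hM : 0 < M)
    (hMe : M ^ (-(1 / 2 : ℝ)) ≤ Real.exp (-1)) (hn : κM⁻¹ * dΩ - b ≤ (n : ℝ)) :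
    walkFactor C c M δ₀ n dω ≤
      walkFactorS (C * Real.exp b) c M (1 / 2) δ₀ n dω * Real.exp (-(κM⁻¹ * dΩ)) := by
  unfold walkFactor walkFactorS
  have h1 : M ^ (-((n : ℝ) / 2)) = (M ^ (-(1 / 2 : ℝ))) ^ n := by
    rw [← Real.rpow_natCast, ← Real.rpow_mul hM.le]; congr 1; ring
  have h2 : (M ^ (-(1 / 2 : ℝ))) ^ n ≤ Real.exp (-1) ^ n :=
    pow_le_pow_left₀ (by positivity) hMe n
  have h3 : Real.exp (-1) ^ n = Real.exp (-(n : ℝ)) := by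
    rw [← Real.exp_nat_mul]; congr 1; ring
  have h4 : Real.exp (-(n : ℝ)) ≤ Real.exp b * Real.exp (-(κM⁻¹ * dΩ)) := by
    rw [← Real.exp_add]; exact Real.exp_le_exp.mpr (by linarith)
  have hmono : M ^ (-((n : ℝ) / 2)) ≤ Real.exp b * Real.exp (-(κM⁻¹ * dΩ)) := by
    rw [h1]; exact h2.trans (h3 ▸ h4)
  have hP : 0 ≤ C * (c * M ^ (-(1 / 2 : ℝ))) ^ n := by positivity
  have hE : 0 ≤ Real.exp (-(δ₀ / 2 * dω)) := (Real.exp_pos _).le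
  calc C * (c * M ^ (-(1 / 2 : ℝ))) ^ n * M ^ (-((n : ℝ) / 2)) * Real.exp (-(δ₀ / 2 * dω))
      ≤ C * (c * M ^ (-(1 / 2 : ℝ))) ^ n * (Real.exp b * Real.exp (-(κM⁻¹ * dΩ))) *
          Real.exp (-(δ₀ / 2 * dω)) :=
        mul_le_mul_of_nonneg_right (mul_le_mul_of_nonneg_left hmono hP) hE
    _ = C * Real.exp b * (c * M ^ (-(1 / 2 : ℝ))) ^ n * Real.exp (-(δ₀ / 2 * dω)) *
          Real.exp (-(κM⁻¹ * dΩ)) := by ring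

/-- M ≥ e² gives the threshold M^{−1/2} ≤ e^{−1} of route (ii) ("for M sufficiently large"). [folklore] -/
theorem rpow_neg_half_le_exp_neg_one {M : ℝ} (hM : Real.exp 2 ≤ M) :
    M ^ (-(1 / 2 : ℝ)) ≤ Real.exp (-1) := by
  have h := Real.rpow_le_rpow_of_nonpos (Real.exp_pos 2) hM (by norm_num : -(1 / 2 : ℝ) ≤ 0)
  have h2 : Real.exp 2 ^ (-(1 / 2 : ℝ)) = Real.exp (-1) := by
    rw [← Real.exp_mul]; norm_num
  rwa [h2] at h

end Arithmetic

section Assembly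

variable {I : Type} {c35 : ℝ} {geo : I → Geometry} {bg : I → Backgrounds}
  {Kdiff : ∀ i, KernelFamily (geo i) (bg i)} {OmK : ∀ i, (geo i).Site → Prop}
  {dOmega : ∀ i, (geo i).Site → (geo i).Site → ℝ} {Ediff : ∀ i, RWExpansion (geo i) (bg i)}

/-- **The printed proof, route (i), assembled** (kernel-checked bookkeeping): the cancellation leaf, the geometry of
(3.93)/(3.154) with a diameter bound `φ(M)` for the localisation domains, and the summation leaf give Theorem 3.14's sup
entries in the M-DEPENDENT-CONSTANT reading `Thm314SupDep` with B₀(M) = C·e^{½δ₀φ(M)}·B₁ and the uniform rate ¼δ₀ for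
the factor (3.154) (δ₀ = the rate of (3.108)).  With φ(M) of order M (the Sect. C domains) the constant is e^{O(δ₀M)} —
cell GAPS G-B9-19.  (`hnorm`: |λ| ≥ 0.) [cite: Balaban1985BackgroundPropagators, Thm 3.14 proof p.427] -/
theorem thm314Dep_of_leaves_exp (D : ∀ i, LocData (geo i) (bg i) (Ediff i))
    (L : ∀ i, (D i).Laws (dOmega i)) (φ : ℝ → ℝ) (hφ : ∀ i, (D i).diam ≤ φ (geo i).M)
    (hnorm : ∀ (i : I) (lam : (geo i).Loc), 0 ≤ (geo i).supNorm lam)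
    (hA : DiffExpansionPrinted c35 geo bg Ediff (fun i => (D i).Touches))
    (hS : RWSumFactorYields geo bg Ediff Kdiff OmK) :
    ∃ M₅ δ₁ a₀ δ₀ C B₁ : ℝ, 0 < M₅ ∧ 0 < δ₁ ∧ 0 < a₀ ∧ 0 < δ₀ ∧ 0 < C ∧ 0 < B₁ ∧
      Thm314SupDep c35 geo bg Kdiff OmK dOmega M₅ δ₁ a₀
        (fun M => C * Real.exp (δ₀ / 2 * φ M) * B₁) (fun _ => δ₀ / 2 / 2) := by
  obtain ⟨M₂, a₀, δ₀, C, c, hM₂, ha₀, hδ₀, hC, hc, HA⟩ := hA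
  obtain ⟨M₃, B₁, δ₁, hM₃, hB₁, hδ₁, HS⟩ := hS c 1 (δ₀ / 2) hc one_pos (by linarith)
  refine ⟨max M₂ M₃, δ₁, a₀, δ₀, C, B₁, lt_max_of_lt_left hM₂, hδ₁, ha₀, hδ₀, hC, hB₁, ?_⟩
  intro i hMi α₀ hα hMa U hU
  have hM2i : M₂ ≤ (geo i).M := le_trans (le_max_left _ _) hMi
  have hMpos : 0 < (geo i).M := lt_of_lt_of_le hM₂ hM2i
  obtain ⟨hconv, htouch, hterm⟩ := HA i hM2i α₀ hα hMa U hU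
  refine HS i (le_trans (le_max_right _ _) hMi) U (C * Real.exp (δ₀ / 2 * φ (geo i).M))
    (fun y y' => Real.exp (-(δ₀ / 2 / 2 * dOmega i y y'))) (by positivity)
    (fun y y' => (Real.exp_pos _).le) hconv ?_
  intro ω lam y y' hy hy' _ _ hlam
  have hgeo : dOmega i y y' ≤ (Ediff i).wdist ω y y' + 2 * φ (geo i).M := by
    have := dOmega_le_wdist_add (D i) (L i) hy hy' (htouch ω)
    linarith [hφ i]
  have hsplit := walkFactorS_split_exp (A := C) (c := c) (M := (geo i).M) (s := 1) (δ := δ₀)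
    (n := (Ediff i).wlen ω) (dω := (Ediff i).wdist ω y y') hC.le hc.le hMpos hδ₀.le hgeo
  have ht := hterm ω lam y y' hy hy' hlam
  rw [walkFactor_eq_walkFactorS hMpos] at ht
  refine le_trans ht ?_
  refine le_trans (mul_le_mul_of_nonneg_right (mul_le_mul_of_nonneg_left hsplit (sq_nonneg _))
    (hnorm i lam)) ?_
  exact le_of_eq (by ring)

/-- **The printed proof, route (ii) (= the template B4 p. 579), assembled** (kernel-checked bookkeeping): the
cancellation leaf, the step count |ω| ≥ (κM)^{−1}d(y, y′, Ω) − b for walks touching Ωᶜ, and the summation leaf (at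
s = ½) give Theorem 3.14's sup entries in the reading `Thm314SupDep` with an M-UNIFORM constant C·e^{b}·B₁ and the
M-DEPENDENT RATE (κM)^{−1} for the factor (3.154) — B4's "δ₀ … depending on d, M only" (p. 573; cell GAPS G-B4-01a),
for M ≥ max(M₂, M₃, e²). [cite: Balaban1985BackgroundPropagators, Thm 3.14 proof p.427]
[cite: Balaban1983RegularityDecay, proof of the Theorem p.579] -/
theorem thm314Dep_of_leaves_steps {Touches : ∀ i, (Ediff i).Walk → Prop} (κ b : ℝ)
    (hstep : ∀ i, StepCountPrinted (Ediff i) (Touches i) (dOmega i) (κ * (geo i).M) b)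
    (hnorm : ∀ (i : I) (lam : (geo i).Loc), 0 ≤ (geo i).supNorm lam)
    (hA : DiffExpansionPrinted c35 geo bg Ediff Touches) (hS : RWSumFactorYields geo bg Ediff Kdiff OmK) :
    ∃ M₅ δ₁ a₀ C B₁ : ℝ, 0 < M₅ ∧ 0 < δ₁ ∧ 0 < a₀ ∧ 0 < C ∧ 0 < B₁ ∧
      Thm314SupDep c35 geo bg Kdiff OmK dOmega M₅ δ₁ a₀
        (fun _ => C * Real.exp b * B₁) (fun M => (κ * M)⁻¹) := by
  obtain ⟨M₂, a₀, δ₀, C, c, hM₂, ha₀, hδ₀, hC, hc, HA⟩ := hA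
  obtain ⟨M₃, B₁, δ₁, hM₃, hB₁, hδ₁, HS⟩ := hS c (1 / 2) δ₀ hc (by norm_num) hδ₀
  refine ⟨max (max M₂ M₃) (Real.exp 2), δ₁, a₀, C, B₁,
    lt_max_of_lt_left (lt_max_of_lt_left hM₂), hδ₁, ha₀, hC, hB₁, ?_⟩
  intro i hMi α₀ hα hMa U hU
  have hM2i : M₂ ≤ (geo i).M := le_trans (le_trans (le_max_left _ _) (le_max_left _ _)) hMi
  have hM3i : M₃ ≤ (geo i).M := le_trans (le_trans (le_max_right _ _) (le_max_left _ _)) hMi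
  have hMe : Real.exp 2 ≤ (geo i).M := le_trans (le_max_right _ _) hMi
  have hMpos : 0 < (geo i).M := lt_of_lt_of_le hM₂ hM2i
  obtain ⟨hconv, htouch, hterm⟩ := HA i hM2i α₀ hα hMa U hU
  refine HS i hM3i U (C * Real.exp b)
    (fun y y' => Real.exp (-((κ * (geo i).M)⁻¹ * dOmega i y y'))) (by positivity)
    (fun y y' => (Real.exp_pos _).le) hconv ?_
  intro ω lam y y' hy hy' _ _ hlam
  have hn := hstep i ω y y' hy hy' (htouch ω)
  have hsplit := walkFactor_split_steps (δ₀ := δ₀) (dω := (Ediff i).wdist ω y y') hC.le hc.le hMpos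
    (rpow_neg_half_le_exp_neg_one hMe) hn
  have ht := hterm ω lam y y' hy hy' hlam
  refine le_trans ht ?_
  refine le_trans (mul_le_mul_of_nonneg_right (mul_le_mul_of_nonneg_left hsplit (sq_nonneg _))
    (hnorm i lam)) ?_
  exact le_of_eq (by ring)

/-- **Route (i) under an M-UNIFORM diameter bound** gives the M-uniform reading `Thm314SupOn` (one rate
δ = min(δ₁, ¼δ₀) for both exponentials, using d ≥ 0, d(·, ·, Ω) ≥ 0, the scale prefactors ≥ 0 and |λ| ≥ 0).  The
hypothesis `hr` (every localisation domain meeting Ωᶜ lies within |·|-distance r₀ of Ωᶜ ∩ T^{(k)}, r₀ INDEPENDENT of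
M) is displayed, not asserted: for the domains of Sect. C it fails (diameters of order M), which is the located content
of cell GAPS G-B9-19 / this unit's row. [cite: Balaban1985BackgroundPropagators, Thm 3.14 pp.426–427] -/
theorem thm314SupOn_of_leaves_exp (D : ∀ i, LocData (geo i) (bg i) (Ediff i))
    (L : ∀ i, (D i).Laws (dOmega i)) (r₀ : ℝ) (hr : ∀ i, (D i).diam ≤ r₀)
    (hnorm : ∀ (i : I) (lam : (geo i).Loc), 0 ≤ (geo i).supNorm lam)
    (hpref : ∀ (i : I) (n : Fin 4) (y : (geo i).Site), 0 ≤ pref4 ((geo i).len y) n)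
    (hd : ∀ (i : I) (y y' : (geo i).Site), 0 ≤ (geo i).dist y y')
    (hdΩ : ∀ (i : I) (y y' : (geo i).Site), 0 ≤ dOmega i y y')
    (hA : DiffExpansionPrinted c35 geo bg Ediff (fun i => (D i).Touches))
    (hS : RWSumFactorYields geo bg Ediff Kdiff OmK) :
    Thm314SupOn c35 geo bg Kdiff OmK dOmega := by
  obtain ⟨M₅, δ₁, a₀, δ₀, C, B₁, hM₅, hδ₁, ha₀, hδ₀, hC, hB₁, H⟩ :=
    thm314Dep_of_leaves_exp D L (fun _ => r₀) hr hnorm hA hS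
  refine ⟨M₅, min δ₁ (δ₀ / 2 / 2), a₀, C * Real.exp (δ₀ / 2 * r₀) * B₁, hM₅,
    lt_min hδ₁ (by positivity), ha₀, by positivity, ?_⟩
  intro i hMi α₀ hα hMa U hU n lam y y' hPy hPy' hlam
  have h := H i hMi α₀ hα hMa U hU n lam y y' hPy hPy' hlam
  beta_reduce at h
  have e1 : Real.exp (-(δ₁ * (geo i).dist y y')) ≤
      Real.exp (-(min δ₁ (δ₀ / 2 / 2) * (geo i).dist y y')) :=
    Real.exp_le_exp.mpr (neg_le_neg (mul_le_mul_of_nonneg_right (min_le_left _ _) (hd i y y')))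
  have e2 : Real.exp (-(δ₀ / 2 / 2 * dOmega i y y')) ≤
      Real.exp (-(min δ₁ (δ₀ / 2 / 2) * dOmega i y y')) :=
    Real.exp_le_exp.mpr (neg_le_neg (mul_le_mul_of_nonneg_right (min_le_right _ _) (hdΩ i y y')))
  have hB : 0 ≤ C * Real.exp (δ₀ / 2 * r₀) * B₁ * pref4 ((geo i).len y) n :=
    mul_nonneg (by positivity) (hpref i n y)
  refine le_trans h (mul_le_mul_of_nonneg_right ?_ (hnorm i lam))
  exact mul_le_mul (mul_le_mul_of_nonneg_left e1 hB) e2 (Real.exp_pos _).le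
    (mul_nonneg hB (Real.exp_pos _).le)

/-- **Route (i) under an M-uniform diameter bound, without the localisation restriction, gives literally the
sibling's `B9.Thm314Printed`** (unit r1's typed statement) — the kernel-checked form of "Theorem 3.14 ⇐ (cancellation
of the walks inside Ω) + (the geometry of (3.93)/(3.154)) + (the Sect. C summation)", with the M-uniformity entering
ONLY through `hr`. [cite: Balaban1985BackgroundPropagators, Thm 3.14 (3.154) pp.426–427] -/
theorem thm314Printed_of_leaves (D : ∀ i, LocData (geo i) (bg i) (Ediff i))
    (L : ∀ i, (D i).Laws (dOmega i)) (r₀ : ℝ) (hr : ∀ i, (D i).diam ≤ r₀)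
    (hnorm : ∀ (i : I) (lam : (geo i).Loc), 0 ≤ (geo i).supNorm lam)
    (hpref : ∀ (i : I) (n : Fin 4) (y : (geo i).Site), 0 ≤ pref4 ((geo i).len y) n)
    (hd : ∀ (i : I) (y y' : (geo i).Site), 0 ≤ (geo i).dist y y')
    (hdΩ : ∀ (i : I) (y y' : (geo i).Site), 0 ≤ dOmega i y y')
    (hA : DiffExpansionPrinted c35 geo bg Ediff (fun i => (D i).Touches))
    (hS : RWSumFactorYields geo bg Ediff Kdiff (fun _ _ => True)) :
    Thm314Printed c35 geo bg Kdiff dOmega :=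
  thm314Printed_iff_supOn_univ.mpr (thm314SupOn_of_leaves_exp D L r₀ hr hnorm hpref hd hdΩ hA hS)

end Assembly

end Literature.MathematicalPhysics.QuantumFieldTheory.Balaban1983to89.B9Thm314
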